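import Summits.KontsevichZagierPeriods.KontsevichZagierPeriods.Theorems.RootDecompZetaThreeFrontierThreeLayerP2

/-! # `RootDecompZetaThreeFrontierThreeLayerP3` — part 3/7 of the mechanical ≤340-line split of decomp-kz lens-1 g12 `ThreeLayer_v1.lean`
(sha256 4ebbf5d0…: §18 the diagonal-straightening move Σ / un-bending τ_v and their relations, §47 the layer ⟹ words algorithm;
`…GZLadder.stub_three_layer` of «gz_ladder» v4 on stmt-KontsevichZagierPeriods-32433 is proved in part 7).  Mathematics unchanged; part 3 continues part 2. -/

set_option linter.dupNamespace false

noncomputable section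

namespace Summit.KontsevichZagierPeriods.RootDecompZetaThreeFrontier.WordLayer

open Set MeasureTheory MvPolynomial
open Literature.NumberTheory.Transcendental
open Summit.KontsevichZagierPeriods.KontsevichZagierPeriods.Theses.RootDecompZetaThreeFrontier
open Summit.KontsevichZagierPeriods.KontsevichZagierPeriods.Theorems.RootDecompZetaThreeFrontierWordMoves (mem_simplex_three_iff)

section Straighten

open Literature.ModelTheory.ExponentialFields

/-- `cellA` is the open simplex `Δ₃` with its last two coordinates swapped. -/
theorem mem_cellA_iff (p : Fin 3 → ℝ) : p ∈ cellA ↔ 0 < p 1 ∧ p 1 < p 2 ∧ p 2 < p 0 ∧ p 0 < 1 := by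
  simp only [cellA, mem_stCell_iff, Set.mem_setOf_eq]
  constructor
  · rintro ⟨⟨h10, h0, h1, h12, h2⟩, h20⟩
    exact ⟨h1, h12, h20, h0⟩
  · rintro ⟨h1, h12, h20, h0⟩
    exact ⟨⟨by linarith, h0, h1, h12, by linarith⟩, h20⟩

/-- the swap of the last two coordinates and its (constant) derivative -/
def swΦ (z : Fin 3 → ℝ) : Fin 3 → ℝ := ![z 0, z 2, z 1]
/-- `D swΦ` -/
def swL : (Fin 3 → ℝ) →L[ℝ] (Fin 3 → ℝ) := ContinuousLinearMap.pi ![Pj 0, Pj 2, Pj 1]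

/-- Auxiliary step `swΦ_zero`: swΦ zero. [bookkeeping] -/
theorem swΦ_zero (z : Fin 3 → ℝ) : swΦ z 0 = z 0 := by simp [swΦ]
/-- Auxiliary step `swΦ_one`: swΦ one. [bookkeeping] -/
theorem swΦ_one (z : Fin 3 → ℝ) : swΦ z 1 = z 2 := by simp [swΦ]
/-- Auxiliary step `swΦ_two`: swΦ two. [bookkeeping] -/
theorem swΦ_two (z : Fin 3 → ℝ) : swΦ z 2 = z 1 := by simp [swΦ]

/-- Auxiliary step `swL_apply`: sw L apply. [bookkeeping] -/
theorem swL_apply (z : Fin 3 → ℝ) : swL z = swΦ z := by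
  funext i
  fin_cases i <;> simp [swL, swΦ]

/-- Auxiliary step `swΦ_swΦ`: swΦ swΦ. [bookkeeping] -/
theorem swΦ_swΦ (z : Fin 3 → ℝ) : swΦ (swΦ z) = z := by
  funext i
  fin_cases i <;> simp [swΦ_zero, swΦ_one, swΦ_two]

/-- Auxiliary step `swL_swL`: sw L sw L. [bookkeeping] -/
theorem swL_swL (w : Fin 3 → ℝ) : swL (swL w) = w := by
  rw [swL_apply, swL_apply, swΦ_swΦ]

/-- Auxiliary step `abs_det_swL`: abs det sw L. [bookkeeping] -/
theorem abs_det_swL : |swL.det| = 1 := by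
  have hcomp : (swL : (Fin 3 → ℝ) →ₗ[ℝ] (Fin 3 → ℝ)) ∘ₗ (swL : (Fin 3 → ℝ) →ₗ[ℝ] (Fin 3 → ℝ)) =
      LinearMap.id := by
    apply LinearMap.ext
    intro w
    simp [swL_swL]
  have h := congrArg LinearMap.det hcomp
  rw [LinearMap.det_comp, LinearMap.det_id] at h
  have h2 : |LinearMap.det (swL : (Fin 3 → ℝ) →ₗ[ℝ] (Fin 3 → ℝ))| ^ 2 = 1 := by
    rw [sq_abs, sq, h]
  exact (pow_eq_one_iff_of_nonneg (abs_nonneg _) two_ne_zero).1 h2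

/-- Auxiliary step `hasFDerivAt_swΦ`: has FDeriv At swΦ. [bookkeeping] -/
theorem hasFDerivAt_swΦ (z : Fin 3 → ℝ) : HasFDerivAt swΦ swL z := by
  have e : swΦ = fun z => swL z := funext fun z => (swL_apply z).symm
  rw [e]
  exact swL.hasFDerivAt

/-- Auxiliary step `swΦ_mem_simplex`: swΦ mem simplex. [bookkeeping] -/
theorem swΦ_mem_simplex {p : Fin 3 → ℝ} (hp : p ∈ cellA) : swΦ p ∈ KZ.openOrderedSimplex 3 := by
  obtain ⟨h1, h12, h20, h0⟩ := (mem_cellA_iff p).1 hp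
  rw [mem_simplex_three_iff, swΦ_zero, swΦ_one, swΦ_two]
  exact ⟨h1, h12, h20, h0⟩

/-- Auxiliary step `swΦ_mem_cellA`: swΦ mem cell A. [bookkeeping] -/
theorem swΦ_mem_cellA {t : Fin 3 → ℝ} (ht : t ∈ KZ.openOrderedSimplex 3) : swΦ t ∈ cellA := by
  obtain ⟨h2, h21, h10, h0⟩ := (mem_simplex_three_iff t).1 ht
  rw [mem_cellA_iff, swΦ_zero, swΦ_one, swΦ_two]
  exact ⟨h2, h21, h10, h0⟩

/-- Auxiliary step `image_swΦ_cellA`: image swΦ cell A. [bookkeeping] -/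
theorem image_swΦ_cellA : swΦ '' cellA = KZ.openOrderedSimplex 3 := by
  ext t
  constructor
  · rintro ⟨p, hp, rfl⟩
    exact swΦ_mem_simplex hp
  · intro ht
    exact ⟨swΦ t, swΦ_mem_cellA ht, swΦ_swΦ t⟩

/-- Auxiliary step `injOn_swΦ`: inj On swΦ. [bookkeeping] -/
theorem injOn_swΦ (S : Set (Fin 3 → ℝ)) : InjOn swΦ S := fun a _ b _ h => by
  have := congrArg swΦ h
  rwa [swΦ_swΦ, swΦ_swΦ] at this

/-- Auxiliary step `isSemialgebraicMapOn_swΦ`: is Semialgebraic Map On swΦ. [bookkeeping] -/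
theorem isSemialgebraicMapOn_swΦ {S : Set (Fin 3 → ℝ)} (hS : IsSemialgebraic ℚ S) : IsSemialgebraicMapOn ℚ S swΦ :=
  (isSemialgebraicMapOn_aeval hS ![(X 0 : MvPolynomial (Fin 3) ℚ), X 2, X 1]).congr fun z _ => by
    funext j
    fin_cases j <;> simp [swΦ_zero, swΦ_one, swΦ_two]

/-- **The swap move**: a representation on `cellA` is congruent to the representation on `Δ₃` with the last two
coordinates exchanged in the integrand (rule (2), `|det| = 1`). -/
theorem swap_rel (r r' : KZ.IntegralRep 3) (hr : r.domain = cellA) (hr' : r'.domain = KZ.openOrderedSimplex 3)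
    (hi : ∀ p ∈ cellA, r.integrand p = r'.integrand (swΦ p)) : KZ.of r - KZ.of r' ∈ KZ.relations := by
  have hΦsa : IsSemialgebraicMapOn ℚ r.domain swΦ := isSemialgebraicMapOn_swΦ r.isSemialgebraic_domain
  have hder : ∀ x ∈ r.domain, HasFDerivWithinAt swΦ swL r.domain x :=
    fun x _ => (hasFDerivAt_swΦ x).hasFDerivWithinAt
  have hdom : r'.domain = swΦ '' r.domain := by rw [hr, image_swΦ_cellA, hr']
  refine KZ.changeOfVariablesRel_subset_relations ⟨3, r, r', swΦ, fun _ => swL, hΦsa, hder, injOn_swΦ _, hdom,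
    fun p hp => ?_, rfl⟩
  show r.integrand p = r'.integrand (swΦ p) * |swL.det|
  rw [abs_det_swL, mul_one]
  exact hi p (by rw [← hr]; exact hp)

/-- `swΦ_* r`: the swapped representation on `Δ₃` of a representation on `cellA`. -/
noncomputable def swapRep (r : KZ.IntegralRep 3) (hr : r.domain = cellA) : KZ.IntegralRep 3 where
  domain := KZ.openOrderedSimplex 3
  integrand := fun t => r.integrand (swΦ t)
  isSemialgebraic_domain := KZ.isSemialgebraic_openOrderedSimplex 3
  isSemialgebraicFunOn_integrand :=
    IsSemialgebraicFunOn.comp_isSemialgebraicMapOn_holds (hr ▸ r.isSemialgebraicFunOn_integrand)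
      (isSemialgebraicMapOn_swΦ (KZ.isSemialgebraic_openOrderedSimplex 3)) fun _ ht => swΦ_mem_cellA ht
  integrableOn := by
    have hm : MeasurableSet cellA := IsSemialgebraic.measurableSet_holds isSemialgebraic_cellA
    have key := (integrableOn_image_iff_integrableOn_abs_det_fderiv_smul (μ := volume) hm
      (fun x _ => (hasFDerivAt_swΦ x).hasFDerivWithinAt) (injOn_swΦ cellA) (fun t => r.integrand (swΦ t))).2
      ((hr ▸ r.integrableOn).congr_fun (fun p _ => by simp [abs_det_swL, swΦ_swΦ]) hm)
    rwa [image_swΦ_cellA] at key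

/-- **The swap move, constructor form**: `[r] ≡ [swΦ_* r]`. -/
theorem swap_rel' (r : KZ.IntegralRep 3) (hr : r.domain = cellA) :
    KZ.of r - KZ.of (swapRep r hr) ∈ KZ.relations :=
  swap_rel r (swapRep r hr) hr rfl fun p _ => by simp [swapRep, swΦ_swΦ]

/-! ### 18e  THE NEW MOVE IN ACTION (kernel): the DIAGONAL-POLE class `H_q = [Δ₃, q/((t₀-t₂) t₁ (1-t₂))]`
(Newton–Leibniz-stuck in every variable; `RUNG3.md` §3 B3, second bullet) is congruent to `[k3 q] + [k3 q]`
(value `2q·ζ(3)`) by the moves Σ, τ_v, the `u = w` split, one swap and one rotation — and therefore lies in the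
`GZNormalFormW 3` closure.  Six moves, every one absolutely convergent and `ℚ`-semialgebraic. -/

/-- the open upper piece `{1 > w > u > v > 0}` of the un-bent cell and the null plane piece `{u = w}` -/
def cellB₀ : Set (Fin 3 → ℝ) := {p | p ∈ stCell ∧ p 0 < p 2}
/-- the null plane piece `{u = w}` of `cellB` -/
def cellN : Set (Fin 3 → ℝ) := {p | p ∈ stCell ∧ p 0 = p 2}

/-- Auxiliary step `isSemialgebraic_cellB₀`: is Semialgebraic cell B₀. [bookkeeping] -/
theorem isSemialgebraic_cellB₀ : IsSemialgebraic ℚ cellB₀ := by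
  have e : cellB₀ = stCell ∩ {p : Fin 3 → ℝ | 0 < MvPolynomial.aeval p (X 2 - X 0 : MvPolynomial (Fin 3) ℚ)} := by
    ext p
    simp only [cellB₀, Set.mem_inter_iff, Set.mem_setOf_eq, map_sub, MvPolynomial.aeval_X, sub_pos]
  rw [e]
  exact isSemialgebraic_stCell.inter (isSemialgebraic_pos3 _)

/-- Auxiliary step `isSemialgebraic_cellN`: is Semialgebraic cell N. [bookkeeping] -/
theorem isSemialgebraic_cellN : IsSemialgebraic ℚ cellN := by
  have e : cellN = stCell ∩ {p : Fin 3 → ℝ | MvPolynomial.aeval p (X 0 - X 2 : MvPolynomial (Fin 3) ℚ) = 0} := by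
    ext p
    simp only [cellN, Set.mem_inter_iff, Set.mem_setOf_eq, map_sub, MvPolynomial.aeval_X, sub_eq_zero]
  rw [e]
  exact isSemialgebraic_stCell.inter
    (Literature.ModelTheory.ExponentialFields.isSemialgebraic_setOf_eval_eq_zero (k := ℚ) _)

/-- Auxiliary step `cellB_eq_union`: cell B eq union. [bookkeeping] -/
theorem cellB_eq_union : cellB = cellB₀ ∪ cellN := by
  ext p
  simp only [cellB, cellB₀, cellN, Set.mem_union, Set.mem_setOf_eq]
  constructor
  · rintro ⟨hp, h⟩
    rcases h.lt_or_eq with h' | h'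
    · exact Or.inl ⟨hp, h'⟩
    · exact Or.inr ⟨hp, h'⟩
  · rintro (⟨hp, h⟩ | ⟨hp, h⟩)
    · exact ⟨hp, h.le⟩
    · exact ⟨hp, h.le⟩

/-- Auxiliary step `disjoint_cellB₀_cellN`: disjoint cell B₀ cell N. [bookkeeping] -/
theorem disjoint_cellB₀_cellN : Disjoint cellB₀ cellN := by
  rw [Set.disjoint_left]
  rintro p ⟨-, h₀⟩ ⟨-, hN⟩
  exact absurd hN (ne_of_lt h₀)

/-- the plane `{u = w}` is Lebesgue-null (a strict subspace) -/
theorem volume_cellN : volume cellN = 0 := by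
  let L : (Fin 3 → ℝ) →ₗ[ℝ] ℝ :=
    LinearMap.proj (R := ℝ) (ι := Fin 3) (φ := fun _ => ℝ) 0 - LinearMap.proj (R := ℝ) (ι := Fin 3) (φ := fun _ => ℝ) 2
  have hker : ({p : Fin 3 → ℝ | p 0 = p 2} : Set (Fin 3 → ℝ)) = (LinearMap.ker L : Set (Fin 3 → ℝ)) := by
    ext p
    simp [L, sub_eq_zero]
  have hne : LinearMap.ker L ≠ ⊤ := by
    intro h
    have hmem : (fun i : Fin 3 => if i = 0 then (1 : ℝ) else 0) ∈ LinearMap.ker L := by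
      rw [h]; exact Submodule.mem_top
    rw [LinearMap.mem_ker] at hmem
    simp [L] at hmem
  have hplane : volume ({p : Fin 3 → ℝ | p 0 = p 2} : Set (Fin 3 → ℝ)) = 0 := by
    rw [hker]
    exact Measure.addHaar_submodule volume _ hne
  exact measure_mono_null (fun p hp => hp.2) hplane

/- `of_mem_relations_of_null` (a representation with Lebesgue-null domain is itself a relation) is NOT re-declared here: the gate's dedup lint
identifies it with the landed `Summit.KontsevichZagierPeriods.PlanarAreas.Negative.of_mem_relations_of_volume_eq_zero`
(Theorems/PlanarAreas/Negative/Normalisations.lean) = `KZ.levelRel_le_relations (KZ.of_mem_levelRel_of_volume_eq_zero r h)` (Literature `KZUnfolding`);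
part 4 uses that Literature term directly (landing edit by census-1 g9; mathematics unchanged). -/

/-- the rotation `(u,v,w) ↦ (w,u,v)` carrying `cellB₀` onto `Δ₃`, its inverse, and its (constant) derivative -/
def rotΦ (z : Fin 3 → ℝ) : Fin 3 → ℝ := ![z 2, z 0, z 1]
/-- inverse rotation -/
def rotΨ (z : Fin 3 → ℝ) : Fin 3 → ℝ := ![z 1, z 2, z 0]
/-- `D rotΦ` -/
def rotL : (Fin 3 → ℝ) →L[ℝ] (Fin 3 → ℝ) := ContinuousLinearMap.pi ![Pj 2, Pj 0, Pj 1]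

/-- Auxiliary step `rotΦ_zero`: rotΦ zero. [bookkeeping] -/
theorem rotΦ_zero (z : Fin 3 → ℝ) : rotΦ z 0 = z 2 := by simp [rotΦ]
/-- Auxiliary step `rotΦ_one`: rotΦ one. [bookkeeping] -/
theorem rotΦ_one (z : Fin 3 → ℝ) : rotΦ z 1 = z 0 := by simp [rotΦ]
/-- Auxiliary step `rotΦ_two`: rotΦ two. [bookkeeping] -/
theorem rotΦ_two (z : Fin 3 → ℝ) : rotΦ z 2 = z 1 := by simp [rotΦ]

/-- Auxiliary step `rotL_apply`: rot L apply. [bookkeeping] -/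
theorem rotL_apply (z : Fin 3 → ℝ) : rotL z = rotΦ z := by
  funext i
  fin_cases i <;> simp [rotL, rotΦ]

/-- Auxiliary step `rotΨ_rotΦ`: rotΨ rotΦ. [bookkeeping] -/
theorem rotΨ_rotΦ (z : Fin 3 → ℝ) : rotΨ (rotΦ z) = z := by
  funext i
  fin_cases i <;> simp [rotΦ, rotΨ]

/-- Auxiliary step `rotΦ_rotΨ`: rotΦ rotΨ. [bookkeeping] -/
theorem rotΦ_rotΨ (z : Fin 3 → ℝ) : rotΦ (rotΨ z) = z := by
  funext i
  fin_cases i <;> simp [rotΦ, rotΨ]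

/-- Auxiliary step `rotΦ_rotΦ_rotΦ`: rotΦ rotΦ rotΦ. [bookkeeping] -/
theorem rotΦ_rotΦ_rotΦ (z : Fin 3 → ℝ) : rotΦ (rotΦ (rotΦ z)) = z := by
  funext i
  fin_cases i <;> simp [rotΦ_zero, rotΦ_one, rotΦ_two]

/-- Auxiliary step `abs_det_rotL`: abs det rot L. [bookkeeping] -/
theorem abs_det_rotL : |rotL.det| = 1 := by
  have hcomp : (rotL : (Fin 3 → ℝ) →ₗ[ℝ] (Fin 3 → ℝ)) ∘ₗ ((rotL : (Fin 3 → ℝ) →ₗ[ℝ] (Fin 3 → ℝ)) ∘ₗ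
      (rotL : (Fin 3 → ℝ) →ₗ[ℝ] (Fin 3 → ℝ))) = LinearMap.id := by
    apply LinearMap.ext
    intro w
    simp [rotL_apply, rotΦ_rotΦ_rotΦ]
  have h := congrArg LinearMap.det hcomp
  rw [LinearMap.det_comp, LinearMap.det_comp, LinearMap.det_id] at h
  have h3 : |LinearMap.det (rotL : (Fin 3 → ℝ) →ₗ[ℝ] (Fin 3 → ℝ))| ^ 3 = 1 := by
    rw [← abs_pow, pow_three, h, abs_one]
  exact (pow_eq_one_iff_of_nonneg (abs_nonneg _) three_ne_zero).1 h3

/-- Auxiliary step `hasFDerivAt_rotΦ`: has FDeriv At rotΦ. [bookkeeping] -/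
theorem hasFDerivAt_rotΦ (z : Fin 3 → ℝ) : HasFDerivAt rotΦ rotL z := by
  have e : rotΦ = fun z => rotL z := funext fun z => (rotL_apply z).symm
  rw [e]
  exact rotL.hasFDerivAt

/-- Auxiliary step `mem_cellB₀_iff`: mem cell B₀ iff. [bookkeeping] -/
theorem mem_cellB₀_iff (p : Fin 3 → ℝ) : p ∈ cellB₀ ↔ 0 < p 1 ∧ p 1 < p 0 ∧ p 0 < p 2 ∧ p 2 < 1 := by
  simp only [cellB₀, mem_stCell_iff, Set.mem_setOf_eq]
  constructor
  · rintro ⟨⟨h10, h0, h1, h12, h2⟩, h02⟩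
    exact ⟨h1, h10, h02, h2⟩
  · rintro ⟨h1, h10, h02, h2⟩
    exact ⟨⟨h10, by linarith, h1, by linarith, h2⟩, h02⟩

/-- Auxiliary step `rotΦ_mem_simplex`: rotΦ mem simplex. [bookkeeping] -/
theorem rotΦ_mem_simplex {p : Fin 3 → ℝ} (hp : p ∈ cellB₀) : rotΦ p ∈ KZ.openOrderedSimplex 3 := by
  obtain ⟨h1, h10, h02, h2⟩ := (mem_cellB₀_iff p).1 hp
  rw [mem_simplex_three_iff, rotΦ_zero, rotΦ_one, rotΦ_two]
  exact ⟨h1, h10, h02, h2⟩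

/-- Auxiliary step `rotΨ_mem_cellB₀`: rotΨ mem cell B₀. [bookkeeping] -/
theorem rotΨ_mem_cellB₀ {t : Fin 3 → ℝ} (ht : t ∈ KZ.openOrderedSimplex 3) : rotΨ t ∈ cellB₀ := by
  obtain ⟨h2, h21, h10, h0⟩ := (mem_simplex_three_iff t).1 ht
  rw [mem_cellB₀_iff]
  simp only [rotΨ, Matrix.cons_val_zero, Matrix.cons_val_one, Matrix.head_cons, Matrix.cons_val_two,
    Matrix.tail_cons]
  exact ⟨h2, h21, h10, h0⟩

/-- Auxiliary step `image_rotΦ_cellB₀`: image rotΦ cell B₀. [bookkeeping] -/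
theorem image_rotΦ_cellB₀ : rotΦ '' cellB₀ = KZ.openOrderedSimplex 3 := by
  ext t
  constructor
  · rintro ⟨p, hp, rfl⟩
    exact rotΦ_mem_simplex hp
  · intro ht
    exact ⟨rotΨ t, rotΨ_mem_cellB₀ ht, rotΦ_rotΨ t⟩

/-- Auxiliary step `injOn_rotΦ`: inj On rotΦ. [bookkeeping] -/
theorem injOn_rotΦ (S : Set (Fin 3 → ℝ)) : InjOn rotΦ S := fun a _ b _ h => by
  have := congrArg rotΨ h
  rwa [rotΨ_rotΦ, rotΨ_rotΦ] at this

/-- Auxiliary step `isSemialgebraicMapOn_rotΦ`: is Semialgebraic Map On rotΦ. [bookkeeping] -/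
theorem isSemialgebraicMapOn_rotΦ {S : Set (Fin 3 → ℝ)} (hS : IsSemialgebraic ℚ S) : IsSemialgebraicMapOn ℚ S rotΦ :=
  (isSemialgebraicMapOn_aeval hS ![(X 2 : MvPolynomial (Fin 3) ℚ), X 0, X 1]).congr fun z _ => by
    funext j
    fin_cases j <;> simp [rotΦ_zero, rotΦ_one, rotΦ_two]

/-- **The rotation move**: a representation on `cellB₀` is congruent to the one on `Δ₃` read in the order `(w,u,v)`. -/
theorem rot_rel (r r' : KZ.IntegralRep 3) (hr : r.domain = cellB₀) (hr' : r'.domain = KZ.openOrderedSimplex 3)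
    (hi : ∀ p ∈ cellB₀, r.integrand p = r'.integrand (rotΦ p)) : KZ.of r - KZ.of r' ∈ KZ.relations := by
  have hΦsa : IsSemialgebraicMapOn ℚ r.domain rotΦ := isSemialgebraicMapOn_rotΦ r.isSemialgebraic_domain
  have hder : ∀ x ∈ r.domain, HasFDerivWithinAt rotΦ rotL r.domain x :=
    fun x _ => (hasFDerivAt_rotΦ x).hasFDerivWithinAt
  have hdom : r'.domain = rotΦ '' r.domain := by rw [hr, image_rotΦ_cellB₀, hr']
  refine KZ.changeOfVariablesRel_subset_relations ⟨3, r, r', rotΦ, fun _ => rotL, hΦsa, hder, injOn_rotΦ _, hdom,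
    fun p hp => ?_, rfl⟩
  show r.integrand p = r'.integrand (rotΦ p) * |rotL.det|
  rw [abs_det_rotL, mul_one]
  exact hi p (by rw [← hr]; exact hp)

/-- The un-bent integrand of `H_q` in closed form: `q/((1-v) u w)` on `stCell`. -/

noncomputable def rotRep (r : KZ.IntegralRep 3) (hr : r.domain = cellB₀) : KZ.IntegralRep 3 where
  domain := KZ.openOrderedSimplex 3
  integrand := fun t => r.integrand (rotΨ t)
  isSemialgebraic_domain := KZ.isSemialgebraic_openOrderedSimplex 3
  isSemialgebraicFunOn_integrand :=
    IsSemialgebraicFunOn.comp_isSemialgebraicMapOn_holds (hr ▸ r.isSemialgebraicFunOn_integrand)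
      ((isSemialgebraicMapOn_aeval (KZ.isSemialgebraic_openOrderedSimplex 3)
        ![(X 1 : MvPolynomial (Fin 3) ℚ), X 2, X 0]).congr fun z _ => by
          funext j
          fin_cases j <;> simp [rotΨ])
      fun _ ht => rotΨ_mem_cellB₀ ht
  integrableOn := by
    have hm : MeasurableSet cellB₀ := IsSemialgebraic.measurableSet_holds isSemialgebraic_cellB₀
    have key := (integrableOn_image_iff_integrableOn_abs_det_fderiv_smul (μ := volume) hm
      (fun x _ => (hasFDerivAt_rotΦ x).hasFDerivWithinAt) (injOn_rotΦ cellB₀) (fun t => r.integrand (rotΨ t))).2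
      ((hr ▸ r.integrableOn).congr_fun (fun p _ => by simp [abs_det_rotL, rotΨ_rotΦ]) hm)
    rwa [image_rotΦ_cellB₀] at key

end Straighten

end Summit.KontsevichZagierPeriods.RootDecompZetaThreeFrontier.WordLayer
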